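import Summits.AtomisticToContinuum.BoseEinsteinCondensation.Theorems.BECThomsonPrincipleFibreConductanceStubTransportFlow
import Summits.AtomisticToContinuum.BoseEinsteinCondensation.Theorems.FibreConductance.Negative.FibreVocabulary
import HarnessLib

/-!
# Route `BECThomsonPrinciple`, crux `FibreConductance` (stmt-AtomisticToContinuum-9480),
# line `parseval-shell-bootstrap` — stub `stub_transport`, part II: TRANSPORT REDUCTION

`stub_transport : GradientCorrectorBound → BetaCorrectorBound → FibreConductance`.

Given correctors `J♭` (weak divergence `ε♭ = gradDefect`) and `J♮` (weak divergence
`ε♮ = densDefect`), each measurable and of cost `≤ C L²/‖n‖²`, the flow `J := J₀ − J♭ − J♮` with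
the transport flow `J₀` of part I (`BECThomsonPrincipleFibreConductanceStubTransportFlow`: weak
divergence `q + ε♭ + ε♮`, cost `≤ L²/(4π²‖n‖²)`) realises the crux: weak divergences subtract
(`tr_hasWeakDiv_sub_sub`; the pairings `∫ J♭·∇₀η` are integrable because a finite fibre cost and
the uniform bounds `0 < c ≤ ψ, W ≤ C` put `J♭` in `L²(cell^N)`, `tr_integrable_pairing`), and costs
are subadditive up to the factor `3` (`tr_fibreCost_sub_sub_le`), whence `ρ₀ = min`, `N₀ = max` and
the constant `3(1/(4π²) + C♭ + C♮)`.

References: the line card `Cruxes/FibreConductance/Lines/parseval-shell-bootstrap.md`;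
R. Lyons, Y. Peres, *Probability on Trees and Networks* (2016), Ch. 2 (Thomson's principle: one
admissible flow bounds the resistance) — used only as the idea.
-/

noncomputable section

namespace Summit.AtomisticToContinuum.BoseEinsteinCondensation.Cruxes.FibreConductance.ParsevalShellBootstrap

open MeasureTheory
open scoped ENNReal
open Literature.MathematicalPhysics.QuantumManyBody.BoseGas
open Summit.AtomisticToContinuum.BoseEinsteinCondensation.Theorems.FibreConductance.Negative
  (norm_sum_mul_le_young)

variable {m : ℕ} {L : ℝ}

/-! ### Integrability of the pairings of a finite-cost flow -/

/-- A measurable fibre flow of finite cost pairs integrably with every test gradient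
(`J ∈ L²` by the uniform bounds `0 < c ≤ ψ, W ≤ C`; Young). [folklore] -/
private theorem tr_integrable_pairing (hL : 0 < L) (Φ : PeriodicTrialState (m + 1) L)
    (hΦ : ∀ X, Φ.ψ X ≠ 0) {J : Config (m + 1) → Fin 3 → ℂ} (hJm : Measurable J)
    (hJc : fibreCost Φ J ≠ ∞) {η : Config (m + 1) → ℂ} (hη : ContDiff ℝ 1 η) :
    Integrable (fun X => ∑ l : Fin 3, J X l *
        fderiv ℝ η X (Pi.single 0 (EuclideanSpace.single l (1 : ℝ))))
      (volume.restrict (cellN (m + 1) L)) := by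
  obtain ⟨c, C, hc, hcψ, hψC, hcW, -⟩ := exists_fibre_bounds hL Φ hΦ
  have hC : 0 < C := hc.trans_le ((hcψ 0).trans (hψC 0))
  have hJl : ∀ l : Fin 3, Measurable fun X => J X l := fun l => (measurable_pi_apply l).comp hJm
  set S : Config (m + 1) → ℝ := fun X => ∑ l : Fin 3, ‖J X l‖ ^ 2 with hS
  have hSm : Measurable S := Finset.measurable_sum _ fun l _ => (hJl l).norm.pow_const 2
  have hS0 : ∀ X, 0 ≤ S X := fun X => Finset.sum_nonneg fun l _ => sq_nonneg _
  -- `S ≤ (C²/c) · S W/ψ²`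
  have hSle : ∀ X, S X ≤ C ^ 2 / c * (S X * fibreW Φ X / fibrePsi Φ X ^ 2) := by
    intro X
    have hψ := fibrePsi_pos hL Φ hΦ X
    have hW : 0 < fibreW Φ X := hc.trans_le (hcW X)
    rw [show C ^ 2 / c * (S X * fibreW Φ X / fibrePsi Φ X ^ 2) =
      S X * (C ^ 2 * fibreW Φ X / (c * fibrePsi Φ X ^ 2)) by field_simp]
    refine le_mul_of_one_le_right (hS0 X) ?_
    rw [one_le_div (by positivity)]
    calc c * fibrePsi Φ X ^ 2 ≤ c * C ^ 2 :=
          mul_le_mul_of_nonneg_left (pow_le_pow_left₀ hψ.le (hψC X) 2) hc.le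
      _ ≤ fibreW Φ X * C ^ 2 := mul_le_mul_of_nonneg_right (hcW X) (sq_nonneg _)
      _ = C ^ 2 * fibreW Φ X := mul_comm _ _
  have hSb : ∫⁻ X in cellN (m + 1) L, ENNReal.ofReal (S X) ≤
      ENNReal.ofReal (C ^ 2 / c) * fibreCost Φ J := by
    unfold fibreCost
    rw [← lintegral_const_mul' _ _ ENNReal.ofReal_ne_top]
    refine lintegral_mono fun X => ?_
    rw [← ENNReal.ofReal_mul (by positivity)]
    exact ENNReal.ofReal_le_ofReal (hSle X)
  have hSfin : ∫⁻ X in cellN (m + 1) L, ENNReal.ofReal (S X) ≠ ∞ :=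
    ne_top_of_le_ne_top (ENNReal.mul_ne_top ENNReal.ofReal_ne_top hJc) hSb
  have hSi : Integrable S (volume.restrict (cellN (m + 1) L)) :=
    (lintegral_ofReal_ne_top_iff_integrable hSm.aestronglyMeasurable
      (Filter.Eventually.of_forall hS0)).1 hSfin
  have hdη : ∀ l : Fin 3, Continuous fun X =>
      fderiv ℝ η X (Pi.single 0 (EuclideanSpace.single l (1 : ℝ))) :=
    fun l => (hη.continuous_fderiv one_ne_zero).clm_apply continuous_const
  have hTi : Integrable (fun X => ∑ l : Fin 3,
      ‖fderiv ℝ η X (Pi.single 0 (EuclideanSpace.single l (1 : ℝ)))‖ ^ 2)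
      (volume.restrict (cellN (m + 1) L)) :=
    integrableOn_cellN (continuous_finsetSum _ fun l _ => ((hdη l).norm).pow 2) L
  refine Integrable.mono' ((hSi.const_mul (1 / 2)).add (hTi.const_mul (1 / (2 * 1))))
    (Finset.measurable_sum _ fun l _ =>
      (hJl l).mul (hdη l).measurable).aestronglyMeasurable ?_
  exact Filter.Eventually.of_forall fun X => norm_sum_mul_le_young one_pos

/-! ### Gluing three flows -/

/-- Costs are subadditive up to the factor `3`. [folklore] -/
private theorem tr_fibreCost_sub_sub_le (hL : 0 < L) (Φ : PeriodicTrialState (m + 1) L)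
    (hΦ : ∀ X, Φ.ψ X ≠ 0) {J₀ J₁ J₂ : Config (m + 1) → Fin 3 → ℂ}
    (h₀ : Measurable J₀) (h₁ : Measurable J₁) :
    fibreCost Φ (J₀ - J₁ - J₂) ≤ 3 * fibreCost Φ J₀ + 3 * fibreCost Φ J₁ + 3 * fibreCost Φ J₂ := by
  have hWm := measurable_fibreW Φ
  have hψm := measurable_fibrePsi hL Φ hΦ
  set w : Config (m + 1) → ℝ := fun X => fibreW Φ X / fibrePsi Φ X ^ 2 with hw_def
  have hw : ∀ X, 0 ≤ w X := fun X => div_nonneg (fibreW_nonneg Φ X) (sq_nonneg _)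
  have hcost : ∀ J : Config (m + 1) → Fin 3 → ℂ, fibreCost Φ J =
      ∫⁻ X in cellN (m + 1) L, ENNReal.ofReal ((∑ l : Fin 3, ‖J X l‖ ^ 2) * w X) := by
    intro J
    unfold fibreCost
    simp_rw [hw_def, mul_div_assoc]
  have hS0 : ∀ (J : Config (m + 1) → Fin 3 → ℂ) (X : Config (m + 1)),
      0 ≤ (∑ l : Fin 3, ‖J X l‖ ^ 2) * w X :=
    fun J X => mul_nonneg (Finset.sum_nonneg fun l _ => sq_nonneg _) (hw X)
  have hpt : ∀ X, ENNReal.ofReal ((∑ l : Fin 3, ‖(J₀ - J₁ - J₂) X l‖ ^ 2) * w X) ≤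
      3 * ENNReal.ofReal ((∑ l : Fin 3, ‖J₀ X l‖ ^ 2) * w X) +
      3 * ENNReal.ofReal ((∑ l : Fin 3, ‖J₁ X l‖ ^ 2) * w X) +
      3 * ENNReal.ofReal ((∑ l : Fin 3, ‖J₂ X l‖ ^ 2) * w X) := by
    intro X
    have h3 : (3 : ℝ≥0∞) = ENNReal.ofReal 3 := by norm_num
    have g₀ := hS0 J₀ X
    have g₁ := hS0 J₁ X
    have g₂ := hS0 J₂ X
    rw [h3, ← ENNReal.ofReal_mul (by norm_num), ← ENNReal.ofReal_mul (by norm_num),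
      ← ENNReal.ofReal_mul (by norm_num), ← ENNReal.ofReal_add (by linarith) (by linarith),
      ← ENNReal.ofReal_add (by linarith) (by linarith)]
    refine ENNReal.ofReal_le_ofReal ?_
    have hl : ∀ l : Fin 3, ‖(J₀ - J₁ - J₂) X l‖ ^ 2 ≤
        3 * (‖J₀ X l‖ ^ 2 + ‖J₁ X l‖ ^ 2 + ‖J₂ X l‖ ^ 2) := by
      intro l
      simp only [Pi.sub_apply]
      have h : ‖J₀ X l - J₁ X l - J₂ X l‖ ≤ ‖J₀ X l‖ + ‖J₁ X l‖ + ‖J₂ X l‖ :=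
        (norm_sub_le _ _).trans (by linarith [norm_sub_le (J₀ X l) (J₁ X l)])
      have h2 := mul_le_mul h h (norm_nonneg _) (by positivity)
      nlinarith [h2, sq_nonneg (‖J₀ X l‖ - ‖J₁ X l‖), sq_nonneg (‖J₁ X l‖ - ‖J₂ X l‖),
        sq_nonneg (‖J₀ X l‖ - ‖J₂ X l‖)]
    have hs : ∑ l : Fin 3, ‖(J₀ - J₁ - J₂) X l‖ ^ 2 ≤
        3 * (∑ l : Fin 3, ‖J₀ X l‖ ^ 2 + ∑ l : Fin 3, ‖J₁ X l‖ ^ 2 +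
          ∑ l : Fin 3, ‖J₂ X l‖ ^ 2) := by
      rw [← Finset.sum_add_distrib, ← Finset.sum_add_distrib, Finset.mul_sum]
      exact Finset.sum_le_sum fun l _ => hl l
    nlinarith [hs, hw X]
  rw [hcost, hcost J₀, hcost J₁, hcost J₂]
  refine (lintegral_mono hpt).trans (le_of_eq ?_)
  rw [lintegral_add_left, lintegral_add_left, lintegral_const_mul' _ _ (by norm_num),
    lintegral_const_mul' _ _ (by norm_num), lintegral_const_mul' _ _ (by norm_num)]
  · fun_prop
  · fun_prop

/-- Weak divergences subtract, given integrable pairings and continuous charges. [folklore] -/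
private theorem tr_hasWeakDiv_sub_sub {J₀ J₁ J₂ : Config (m + 1) → Fin 3 → ℂ}
    {σ₀ σ₁ σ₂ : Config (m + 1) → ℂ}
    (h₀ : HasWeakDiv L J₀ σ₀) (h₁ : HasWeakDiv L J₁ σ₁) (h₂ : HasWeakDiv L J₂ σ₂)
    (hσ₀ : Continuous σ₀) (hσ₁ : Continuous σ₁) (hσ₂ : Continuous σ₂)
    (hI : ∀ J ∈ [J₀, J₁, J₂], ∀ η : Config (m + 1) → ℂ, ContDiff ℝ 1 η →
      Integrable (fun X => ∑ l : Fin 3, J X l *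
        fderiv ℝ η X (Pi.single 0 (EuclideanSpace.single l (1 : ℝ))))
        (volume.restrict (cellN (m + 1) L))) :
    HasWeakDiv L (J₀ - J₁ - J₂) (fun X => σ₀ X - σ₁ X - σ₂ X) := by
  intro η hη hper
  have e : ∀ X, ∑ l : Fin 3, (J₀ - J₁ - J₂) X l *
      fderiv ℝ η X (Pi.single 0 (EuclideanSpace.single l (1 : ℝ))) =
      (∑ l : Fin 3, J₀ X l * fderiv ℝ η X (Pi.single 0 (EuclideanSpace.single l (1 : ℝ)))) -
      (∑ l : Fin 3, J₁ X l * fderiv ℝ η X (Pi.single 0 (EuclideanSpace.single l (1 : ℝ)))) -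
      (∑ l : Fin 3, J₂ X l * fderiv ℝ η X (Pi.single 0 (EuclideanSpace.single l (1 : ℝ)))) := by
    intro X
    simp only [Pi.sub_apply, sub_mul, Finset.sum_sub_distrib]
  simp_rw [e]
  rw [integral_sub ((hI J₀ (by simp) η hη).sub' (hI J₁ (by simp) η hη)) (hI J₂ (by simp) η hη),
    integral_sub (hI J₀ (by simp) η hη) (hI J₁ (by simp) η hη), h₀ η hη hper, h₁ η hη hper,
    h₂ η hη hper]
  have e2 : ∀ X, (σ₀ X - σ₁ X - σ₂ X) * η X = σ₀ X * η X - σ₁ X * η X - σ₂ X * η X :=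
    fun X => by ring
  simp_rw [e2]
  have hi : ∀ {σ : Config (m + 1) → ℂ}, Continuous σ →
      Integrable (fun X => σ X * η X) (volume.restrict (cellN (m + 1) L)) :=
    fun hσ => integrableOn_cellN (hσ.fun_mul hη.continuous) L
  rw [integral_sub ((hi hσ₀).sub' (hi hσ₁)) (hi hσ₂), integral_sub (hi hσ₀) (hi hσ₁)]
  ring

/-! ### The reduction -/

/-- **Transport reduction at one datum**: correctors for `ε♭`, `ε♮` give the crux's flow with
constant `3(1/(4π²) + C₁ + C₂)`. [folklore] -/
private theorem tr_main (hL : 0 < L) {n : Fin 3 → ℤ} (hn : n ≠ 0)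
    (Φ : PeriodicTrialState (m + 1) L) (hΦ : ∀ X, Φ.ψ X ≠ 0) {C₁ C₂ : ℝ} (hC₁ : 0 ≤ C₁)
    (hC₂ : 0 ≤ C₂) {J₁ J₂ : Config (m + 1) → Fin 3 → ℂ} (hJ₁m : Measurable J₁)
    (hJ₁d : HasWeakDiv L J₁ (gradDefect n Φ))
    (hJ₁c : fibreCost Φ J₁ ≤ ENNReal.ofReal (C₁ * L ^ 2 / ‖(fun j => (n j : ℝ))‖ ^ 2))
    (hJ₂m : Measurable J₂) (hJ₂d : HasWeakDiv L J₂ (densDefect n Φ))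
    (hJ₂c : fibreCost Φ J₂ ≤ ENNReal.ofReal (C₂ * L ^ 2 / ‖(fun j => (n j : ℝ))‖ ^ 2)) :
    ∃ J : Config (m + 1) → (Fin 3 → ℂ),
      HasWeakDiv L J (fun X => ((Real.sqrt (L ^ 3))⁻¹ : ℂ) *
        (phase L n (X 0) * (fibrePsi Φ X : ℂ) - fibreBeta n Φ X * (fibrePsi Φ X : ℂ) ^ 2)) ∧
      fibreCost Φ J ≤ ENNReal.ofReal
        (3 * (1 / (4 * Real.pi ^ 2) + C₁ + C₂) * L ^ 2 / ‖(fun j => (n j : ℝ))‖ ^ 2) := by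
  -- the transport flow
  set a : Fin 3 → ℂ := fun l => ((Real.sqrt (L ^ 3))⁻¹ : ℂ) *
    ((2 * Real.pi * (n l : ℝ) / L : ℝ) : ℂ) / (Complex.I * (ksq L n : ℂ)) with ha
  set J₀ : Config (m + 1) → Fin 3 → ℂ := fun X l => a l * (phase L n (X 0) * (fibrePsi Φ X : ℂ))
    with hJ₀
  have hψc := continuous_fibrePsi hL Φ hΦ
  have hψC : Continuous fun X => (fibrePsi Φ X : ℂ) := Complex.continuous_ofReal.comp hψc
  have hph := (tr_contDiff_phase0 (m := m) L n (k := 0)).continuous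
  have hβc := continuous_fibreBeta hL n Φ hΦ
  have hJ₀m : Measurable J₀ :=
    measurable_pi_lambda _ fun l => (continuous_const.mul (hph.mul hψC)).measurable
  -- weak divergence of `J₀`
  have hJ₀d : HasWeakDiv L J₀ (fun X => ((Real.sqrt (L ^ 3))⁻¹ : ℂ) *
      (phase L n (X 0) * (fibrePsi Φ X : ℂ) - fibreBeta n Φ X * (fibrePsi Φ X : ℂ) ^ 2) +
        gradDefect n Φ X + densDefect n Φ X) := by
    have h := tr_hasWeakDiv_transport hL n Φ hΦ a
    have he : (fun X => ∑ l : Fin 3, a l * (phase L n (X 0) *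
        ((dPsi Φ X l : ℂ) + 2 * Real.pi * Complex.I * (n l) / L * (fibrePsi Φ X : ℂ)))) =
        fun X => ((Real.sqrt (L ^ 3))⁻¹ : ℂ) *
          (phase L n (X 0) * (fibrePsi Φ X : ℂ) - fibreBeta n Φ X * (fibrePsi Φ X : ℂ) ^ 2) +
            gradDefect n Φ X + densDefect n Φ X :=
      funext fun X => tr_div_identity hL hn Φ X
    rw [← he]
    exact h
  -- cost of `J₀`
  have hJ₀c : fibreCost Φ J₀ ≤
      ENNReal.ofReal (1 / (4 * Real.pi ^ 2) * L ^ 2 / ‖(fun j => (n j : ℝ))‖ ^ 2) :=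
    tr_cost_transport hL hn Φ hΦ
  -- continuity of the charges
  have hphase : Continuous (phase L n) := (contDiff_phase L n (k := 0)).continuous
  have hd : ∀ l : Fin 3, Continuous fun X => dPsi Φ X l := continuous_dPsi hL Φ hΦ
  have hq : Continuous fun X => ((Real.sqrt (L ^ 3))⁻¹ : ℂ) *
      (phase L n (X 0) * (fibrePsi Φ X : ℂ) - fibreBeta n Φ X * (fibrePsi Φ X : ℂ) ^ 2) +
        gradDefect n Φ X + densDefect n Φ X := by
    unfold gradDefect densDefect
    fun_prop
  have hε₁ : Continuous (gradDefect n Φ) := by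
    unfold gradDefect
    fun_prop
  have hε₂ : Continuous (densDefect n Φ) := by
    unfold densDefect
    fun_prop
  -- integrable pairings
  have hx : 0 ≤ L ^ 2 / ‖(fun j => (n j : ℝ))‖ ^ 2 := by positivity
  have hI : ∀ J ∈ [J₀, J₁, J₂], ∀ η : Config (m + 1) → ℂ, ContDiff ℝ 1 η →
      Integrable (fun X => ∑ l : Fin 3, J X l *
        fderiv ℝ η X (Pi.single 0 (EuclideanSpace.single l (1 : ℝ))))
        (volume.restrict (cellN (m + 1) L)) := by
    intro J hJ η hη
    simp only [List.mem_cons, List.not_mem_nil, or_false] at hJ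
    rcases hJ with rfl | rfl | rfl
    · exact tr_integrable_pairing hL Φ hΦ hJ₀m (ne_top_of_le_ne_top ENNReal.ofReal_ne_top hJ₀c) hη
    · exact tr_integrable_pairing hL Φ hΦ hJ₁m (ne_top_of_le_ne_top ENNReal.ofReal_ne_top hJ₁c) hη
    · exact tr_integrable_pairing hL Φ hΦ hJ₂m (ne_top_of_le_ne_top ENNReal.ofReal_ne_top hJ₂c) hη
  refine ⟨J₀ - J₁ - J₂, ?_, ?_⟩
  · have h := tr_hasWeakDiv_sub_sub hJ₀d hJ₁d hJ₂d hq hε₁ hε₂ hI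
    have he : (fun X => ((Real.sqrt (L ^ 3))⁻¹ : ℂ) *
        (phase L n (X 0) * (fibrePsi Φ X : ℂ) - fibreBeta n Φ X * (fibrePsi Φ X : ℂ) ^ 2) +
          gradDefect n Φ X + densDefect n Φ X - gradDefect n Φ X - densDefect n Φ X) =
        fun X => ((Real.sqrt (L ^ 3))⁻¹ : ℂ) *
          (phase L n (X 0) * (fibrePsi Φ X : ℂ) - fibreBeta n Φ X * (fibrePsi Φ X : ℂ) ^ 2) :=
      funext fun X => by ring
    rw [he] at h
    exact h
  · refine (tr_fibreCost_sub_sub_le hL Φ hΦ hJ₀m hJ₁m).trans ?_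
    have h3 : (3 : ℝ≥0∞) = ENNReal.ofReal 3 := by norm_num
    calc 3 * fibreCost Φ J₀ + 3 * fibreCost Φ J₁ + 3 * fibreCost Φ J₂
        ≤ 3 * ENNReal.ofReal (1 / (4 * Real.pi ^ 2) * L ^ 2 / ‖(fun j => (n j : ℝ))‖ ^ 2) +
          3 * ENNReal.ofReal (C₁ * L ^ 2 / ‖(fun j => (n j : ℝ))‖ ^ 2) +
          3 * ENNReal.ofReal (C₂ * L ^ 2 / ‖(fun j => (n j : ℝ))‖ ^ 2) := by gcongr
      _ = ENNReal.ofReal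
          (3 * (1 / (4 * Real.pi ^ 2) + C₁ + C₂) * L ^ 2 / ‖(fun j => (n j : ℝ))‖ ^ 2) := by
        rw [h3, ← ENNReal.ofReal_mul (by norm_num), ← ENNReal.ofReal_mul (by norm_num),
          ← ENNReal.ofReal_mul (by norm_num),
          ← ENNReal.ofReal_add (by positivity) (by positivity),
          ← ENNReal.ofReal_add (by positivity) (by positivity)]
        congr 1
        ring

/-- **Registered stub `stub_transport` — TRANSPORT REDUCTION**:
`GradientCorrectorBound → BetaCorrectorBound → FibreConductance`, with `ρ₀ = min`, `N₀ = max`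
and the constant `3(1/(4π²) + C♭ + C♮)`. [folklore] -/
theorem stub_transport : Goal.stub_transport := by
  intro hG hB v hv hbdd M hM
  obtain ⟨ρ₁, C₁, hρ₁, hC₁, N₁, h₁⟩ := hG v hv hbdd M hM
  obtain ⟨ρ₂, C₂, hρ₂, hC₂, N₂, h₂⟩ := hB v hv hbdd M hM
  refine ⟨min ρ₁ ρ₂, 3 * (1 / (4 * Real.pi ^ 2) + C₁ + C₂), lt_min hρ₁ hρ₂, by positivity,
    max N₁ N₂, ?_⟩
  intro m hm L hL hρ n hn hw Φ hE hz
  have hm₁ : N₁ ≤ m + 1 := le_trans (le_max_left _ _) hm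
  have hm₂ : N₂ ≤ m + 1 := le_trans (le_max_right _ _) hm
  have hL3 : (0 : ℝ) ≤ L ^ 3 := by positivity
  have hρa : ((m + 1 : ℕ) : ℝ) ≤ ρ₁ * L ^ 3 :=
    hρ.trans (mul_le_mul_of_nonneg_right (min_le_left _ _) hL3)
  have hρb : ((m + 1 : ℕ) : ℝ) ≤ ρ₂ * L ^ 3 :=
    hρ.trans (mul_le_mul_of_nonneg_right (min_le_right _ _) hL3)
  obtain ⟨J₁, hJ₁m, hJ₁d, hJ₁c⟩ := h₁ m hm₁ L hL hρa n hn hw Φ hE hz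
  obtain ⟨J₂, hJ₂m, hJ₂d, hJ₂c⟩ := h₂ m hm₂ L hL hρb n hn hw Φ hE hz
  exact tr_main hL hn Φ hz hC₁.le hC₂.le hJ₁m hJ₁d hJ₁c hJ₂m hJ₂d hJ₂c

end Summit.AtomisticToContinuum.BoseEinsteinCondensation.Cruxes.FibreConductance.ParsevalShellBootstrap

end
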